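import Summits.BirchSwinnertonDyer.BirchSwinnertonDyer.Theorems.ErratumRoadFiveNonSurjCornerKolyJProp44SuppliersZhang
import Summits.BirchSwinnertonDyer.BirchSwinnertonDyer.Theorems.ErratumRoadFiveNonSurjCornerKolyJProp44PairData
import Summits.BirchSwinnertonDyer.Rank1Residual.X11b.KolyvaginH37Bridge
import HarnessLib

/-!
# McCallum 1991 Prop. 4.4 (3) at a Zhang–Kolyvagin prime: `ord d_M(mℓ)_λ = ord c_M(mℓ)_λ` — the RAMIFIED class
# `c_M(mℓ)` dies in `H¹(K_λ, E)` only if it dies in `H¹(K_λ, E[p^M])` (cell `bsd-stepL`, seat `bsd-stepL-corner-p1`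
# g10; `--supports stmt-BirchSwinnertonDyer-19947`; memo CORNER-G9 §3 (c) "(A)", CORNER-G10 §1)

WHY/WHAT. x11b3's `h44` programme (and its Zhang re-key `Prop44.h44_of_prop37_at_zhang`) proves McCallum's Prop. 4.4 in
the COMPOSITE order form `p^a c_M(mℓ) ∈ Sel_λ ↔ p^a c_M(m)_λ = 0` (`ord d_M(mℓ)_λ = ord c_M(m)_λ`). The corner's
consumers (the walk's `h47`: `addOrderOf (loc_λ c(sℓ)) = addOrderOf (loc_λ c(s))`; the swap's `h44c`:
`loc_λ κ̄(sℓ) = 0 ↔ loc_λ κ̄(s) = 0`) need the SECOND printed equality `ord c_M(mℓ)_λ = ord c_M(m)_λ`, i.e. additionally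
McCallum's (3) «the composition of `χ_l` with `H¹(K_λ, E_{p^M}) → H¹(K_λ, E)_{p^M}` induces an isomorphism», in
order form: **for every `k`, `k c_M(mℓ) ∈ Sel_λ ⟹ k c_M(mℓ)_λ = 0`** (the converse is the inclusion
`torsionLocalKer ≤ selmerLocalKer`). KERNEL PROOF (image-free, `p`-generic): `k c_M(mℓ) = c(k P_{mℓ})`
(`KolyvaginCocycle.cls_zsmul`); if it is Selmer at `λ` it is unramified, and an unramified class at the good place
`λ ∤ p` vanishes in `H¹(K_λ, E[p^M])` iff `k P̃_{mℓ} ∈ p^M Ẽ(F_λ)` for the reduction `red` modulo the prime `𝔓 ∣ λ`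
and an arithmetic Frobenius `F` at `𝔓` fixing `E[p^M]` AND `P_{mℓ}` (the tree's
`zsmul_kolyvaginClass_mem_torsionLocalKer_iff_of_red`, Gross Prop. 9.6); such an `F` exists: any Frobenius `F₀` fixing
`E[p^M]` (`exists_isArithFrobAt_mem_torsionFixing_of_le_kolyvaginIndex`) restricts into `G_ℓ = ⟨σ_ℓ⟩` on `K_{mℓ}` (it
fixes `K_m`, in which `λ` splits completely), so `F = τ₀^j F₀` with `τ₀ ∈ I_𝔓 ↦ σ_ℓ` (total ramification) restricts
trivially and is still a Frobenius fixing `E[p^M]` (inertia fixes `E[p^M]`: `red` is `I_𝔓`-invariant and injective on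
`E[p^M]`); finally `P̃_{mℓ} = red(D_ℓ · P') = (Σ_{i=1}^{ℓ} i) · P̃' = ℓ(ℓ+1)/2 · P̃' ∈ p^M Ẽ(F_λ)` because `σ_ℓ` is
INERTIAL (`red ∘ τ₀ = red`), `p^M ∣ ℓ + 1`, `p` odd, and `P' = Σ_S σ D_{m} y_{mℓ} ∈ E(K_{mℓ})` is fixed by `F`. Stated
for ABSTRACT level data (the END's currency: `𝒢 ↷ A₀`, `σ`, `L`, `f`, `y`, `π`, `j`, Galois dictionary `e`, `ρ`,
`hπρ`, `hσρ`), one level. HONEST FRAMING: a kernel theorem (no print input); nothing about BSD; no stub closes; T7.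
References: [McCallumLMS1991] Prop. 4.4 (3) and «In particular» (p. 301), proof p. 302 («all the non-zero cocycles
in `im χ_l` are ramified»); [GrossLMS1991] §3 (3.5), §4 (4.1), Prop. 6.2, Prop. 9.6; [WZhang2014] Notations (xii).
-/

set_option autoImplicit false
set_option linter.dupNamespace false

noncomputable section

open scoped Classical
open WeierstrassCurve Field NumberField IsDedekindDomain Finset
open Literature.NumberTheory.EllipticCurves Literature.NumberTheory.GaloisRepresentations
open Literature.NumberTheory.EllipticCurves.KolyvaginCocycle
open Literature.NumberTheory.EllipticCurves.KolyvaginEuler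
open Literature.NumberTheory.NumberFields
open Literature.NumberTheory.EllipticCurves.RingClassField
open Literature.NumberTheory.EllipticCurves.ModularForms
open Summit.BirchSwinnertonDyer.Rank1Residual.X11b
open Summit.BirchSwinnertonDyer.Rank1Residual.X11b.KolyvaginH44

namespace Summit.BirchSwinnertonDyer.BirchSwinnertonDyer.Theorems.Prop44

/-! ## §1 Algebra: `P_L = D_ℓ · P_{L∖ℓ}`; a Frobenius times an inertia element is a Frobenius -/

section Algebra

variable {𝒢 : Type*} [CommGroup 𝒢] {A : Type*} [AddCommGroup A] [DistribMulAction 𝒢 A]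

/-- **`P_L(y) = D_ℓ · P_{L∖ℓ}(y)`** for `ℓ ∈ L`: `Σ_S σ D_L y = D_ℓ (Σ_S σ D_{L∖ℓ} y)` in the commutative group ring
(`D_L = D_ℓ · D_{L∖ℓ}`, Gross 1991 §3 "`D_n = ∏ D_ℓ`"). [cite: GrossLMS1991, §3 (D_n), §4 (4.1)] -/
theorem kolyvaginPoint_eq_grAct_derivElt_erase (σ : ℕ → 𝒢) {L : Finset ℕ} {ℓ : ℕ} (hℓ : ℓ ∈ L)
    {H : Subgroup 𝒢} [Fintype (𝒢 ⧸ H)] (f : 𝒢 ⧸ H → 𝒢) (y : A) :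
    kolyvaginPoint σ L f y = grAct A (derivElt (σ ℓ) ℓ) (kolyvaginPoint σ (L.erase ℓ) f y) := by
  unfold kolyvaginPoint
  have hprod : derivProd σ L = derivElt (σ ℓ) ℓ * derivProd σ (L.erase ℓ) := by
    unfold derivProd
    rw [Finset.mul_prod_erase L (fun q ↦ derivElt (σ q) q) hℓ]
  rw [hprod, map_sum]
  refine Finset.sum_congr rfl fun q _ ↦ ?_
  rw [grAct_mul, grAct_smul_comm]

end Algebra

/-- **A Frobenius multiplied on the left by an inertia element is a Frobenius** at the same prime:
`(τσ)x − x^q = (τ(σx) − σx) + (σx − x^q)`. [folklore] -/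
theorem isArithFrobAt_mul_of_mem_inertia {R S G : Type*} [CommRing R] [CommRing S] [Algebra R S] [Group G]
    [MulSemiringAction G S] [SMulCommClass G R S] {Q : Ideal S} {σ τ : G}
    (hσ : IsArithFrobAt R σ Q) (hτ : τ ∈ Q.inertia G) : IsArithFrobAt R (τ * σ) Q := by
  intro x
  have h1 : τ • (σ • x) - σ • x ∈ Q := hτ (σ • x)
  have h2 : σ • x - x ^ Nat.card (R ⧸ Q.under R) ∈ Q := hσ x
  have h3 := add_mem h1 h2
  rw [sub_add_sub_cancel, ← mul_smul] at h3
  exact h3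

/-! ## §2 The ramified class: Selmer at `λ` only if locally zero at `λ` -/

section Ramified

-- `K : Type`: the tree's ring-class class field theory (and the JET bricks) are universe `0`.
variable {K : Type} [Field K] [NumberField K] {W : WeierstrassCurve ℚ} [W.IsElliptic] [W.IsGloballyMinimal]

set_option maxHeartbeats 800000 in
/-- **McCallum 1991, Prop. 4.4 (3) in order form at a Zhang–Kolyvagin prime — `ord d_M(mℓ)_λ = ord c_M(mℓ)_λ`.**
For `K` imaginary quadratic, `E = W/ℚ` globally minimal, `p` odd, `M`, abstract level-`n` Euler data
(`𝒢 ↷ A₀`, generators `σ`, primes `L ∋ ℓ`, section `f`, `y`, restriction `π : Γ_K → 𝒢`, `π`-equivariant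
`j : A₀ → E(K̄)` with admissible image and invariant Kolyvagin point `P = j(Σ_S σ D_L y)`) with its Galois dictionary
(`e : K[n] → K̄`, injective `ρ : 𝒢 → Aut_ℚ(K[n])`, `τ • e x = e (ρ (π τ) x)`, `ρ(⟨σ ℓ⟩) = Gal(K[n]/K[n] ∩ K[n/ℓ])`,
`σ_ℓ^{ℓ+1} = 1`), a Zhang–Kolyvagin prime `ℓ ∥ n` of index `≥ M` and the place `λ ∋ ℓ`: for every `k`, if `k · c(P)`
satisfies the Selmer condition at `λ` then `k · c(P)` vanishes in `H¹(K_λ, E[p^M])`. Kernel proof (module docstring).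
[cite: McCallumLMS1991, Prop. 4.4 (3) (p. 301), proof (p. 302)] [cite: GrossLMS1991, Prop. 9.6, §4 (4.1)]
[cite: WZhang2014, Notations (xii)] -/
theorem zsmul_kolyvaginClass_mem_torsionLocalKer_of_mem_selmerLocalKer (hK : IsImaginaryQuadratic K) (ι : K →+* ℂ)
    {p M : ℕ} (hp : p.Prime) (hp2 : p ≠ 2)
    (hdiv : ∀ Q : geomPoints (W.baseChange K), ∃ R, ((p ^ M : ℕ) : ℤ) • R = Q)
    {𝒢 : Type*} [CommGroup 𝒢] {A₀ : Type*} [AddCommGroup A₀] [DistribMulAction 𝒢 A₀]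
    (σ : ℕ → 𝒢) (L : Finset ℕ) {H : Subgroup 𝒢} [Fintype (𝒢 ⧸ H)] (f : 𝒢 ⧸ H → 𝒢) (y : A₀)
    (π : absoluteGaloisGroup K →* 𝒢) (j : A₀ →+ geomPoints (W.baseChange K))
    (hj : ∀ (g : absoluteGaloisGroup K) (a : A₀), j (π g • a) = g • j a)
    (hA : IsAdmissible (absoluteGaloisGroup K) j.range ((p ^ M : ℕ) : ℤ))
    (hPt : j (kolyvaginPoint σ L f y) ∈ invPoints (absoluteGaloisGroup K) j.range ((p ^ M : ℕ) : ℤ))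
    {n : ℕ} (hn0 : n ≠ 0) (e : ringClassField K ι n →ₐ[K] AlgebraicClosure K)
    (ρ : 𝒢 →* (ringClassField K ι n ≃ₐ[ℚ] ringClassField K ι n)) (hρ : Function.Injective ρ)
    (hπρ : ∀ (τ : absoluteGaloisGroup K) (x : ringClassField K ι n), τ • e x = e (ρ (π τ) x))
    {ℓ : ℕ} (hℓL : ℓ ∈ L) (hℓn : ℓ ∣ n) (hℓn' : ¬ ℓ ∣ n / ℓ)
    (hℓ : Zhang2014.IsKolyvaginPrime (W.conductorNorm ℤ) W K p ℓ) (hℓM : M ≤ Zhang2014.kolyvaginIndex W p ℓ)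
    (hord : σ ℓ ^ (ℓ + 1) = 1)
    (hσρ : (Subgroup.zpowers (σ ℓ)).map ρ = ringClassGalOver ι n (n / ℓ))
    (v : HeightOneSpectrum (𝓞 K)) (hv : (ℓ : 𝓞 K) ∈ v.asIdeal) (k : ℤ)
    (hsel : k • kolyvaginClass (W.baseChange K) _ hdiv hA (j (kolyvaginPoint σ L f y)) hPt ∈
      selmerLocalKer (W.baseChange K) (v.adicCompletion K) ((p ^ M : ℕ) : ℤ)) :
    k • kolyvaginClass (W.baseChange K) _ hdiv hA (j (kolyvaginPoint σ L f y)) hPt ∈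
      (W.baseChange K).torsionLocalKer (v.adicCompletion K) ((p ^ M : ℕ) : ℤ) := by
  letI : Algebra K ℂ := ι.toAlgebra
  haveI : CharZero (v.adicCompletion K) :=
    charZero_of_injective_algebraMap (algebraMap K (v.adicCompletion K)).injective
  haveI : (W.baseChange K).IsElliptic := inferInstanceAs (W.map (algebraMap ℚ K)).IsElliptic
  haveI : Fact p.Prime := ⟨hp⟩
  have hℓp : ℓ.Prime := hℓ.1
  haveI : Fact ℓ.Prime := ⟨hℓp⟩
  have hpℓ : p ≠ ℓ := fun h ↦ hℓ.2.2.2.1 h.symm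
  have hq0 : p ^ M ≠ 0 := pow_ne_zero M hp.ne_zero
  have hn0Z : ((p ^ M : ℕ) : ℤ) ≠ 0 := by exact_mod_cast hq0
  have hm0 : n / ℓ ≠ 0 := (Nat.div_pos (Nat.le_of_dvd (Nat.pos_of_ne_zero hn0) hℓn) hℓp.pos).ne'
  have hℓpM : ¬ ℓ ∣ p ^ M := fun h ↦
    hpℓ ((Nat.prime_dvd_prime_iff_eq hℓp hp).mp (hℓp.dvd_of_dvd_pow h)).symm
  set P : geomPoints (W.baseChange K) := j (kolyvaginPoint σ L f y) with hPdef
  set nn : ℤ := ((p ^ M : ℕ) : ℤ) with hnn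
  -- ### the place `λ`: good reduction, `λ ∤ p`, uniqueness, `q_λ = ℓ²`, `ℓ ∤ Δ`
  have hgood : (W.baseChange K).HasGoodReductionAt v :=
    (Summit.BirchSwinnertonDyer.Rank1Residual.JET.RingClassTransverse.hasGoodReductionAt_of_zhangKolyvagin
      W K hp hℓ v hv M).1
  have hℓv : (ℓ : 𝓞 ℚ) ∈ (v.under (𝓞 ℚ)).asIdeal := by
    change (ℓ : 𝓞 ℚ) ∈ v.asIdeal.under (𝓞 ℚ)
    rw [Ideal.under_def, Ideal.mem_comap, map_natCast]; exact hv
  have hgoodQ : W.HasGoodReductionAt (v.under (𝓞 ℚ)) :=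
    Summit.BirchSwinnertonDyer.Rank1Residual.X11b.Three.Koly.Method2.LocalFrob.hasGoodReductionAt_rat_of_not_dvd_conductorNorm
      W hℓ.1 hℓ.2.1 _ hℓv
  have hpv : (p : 𝓞 K) ∉ v.asIdeal := not_natCast_mem_of_prime_ne hℓ.1 hp hℓ.2.2.2.1 v hv
  have hnv : ((nn : ℤ) : 𝓞 K) ∉ v.asIdeal := by
    rw [hnn, Int.cast_natCast, Nat.cast_pow]
    exact fun h ↦ hpv (v.isPrime.mem_of_pow_mem M h)
  have huniq : ∀ w : HeightOneSpectrum (𝓞 K), (ℓ : 𝓞 K) ∈ w.asIdeal → w = v := fun w hw ↦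
    Summit.BirchSwinnertonDyer.Rank1Residual.JET.RingClassTransverse.eq_of_natCast_mem_of_isPrime_span K hℓp
      hℓ.2.2.2.2.1 v w hv hw
  have hres : v.residueCard = ℓ ^ 2 := residueCard_eq_sq_of_isPrime_span hK hℓp hℓ.2.2.2.2.1 v hv
  have hΔ : ¬ (ℓ : ℤ) ∣ minimalDiscriminantInt W := by
    obtain ⟨v₀, hv₀, hℓv₀⟩ := exists_ratPlace ℓ
    have hgood₀ : W.HasGoodReductionAt v₀ :=
      Summit.BirchSwinnertonDyer.Rank1Residual.X11b.Three.Koly.Method2.LocalFrob.hasGoodReductionAt_rat_of_not_dvd_conductorNorm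
        W hℓp hℓ.2.1 v₀ hℓv₀
    have h1 := (hasGoodReductionAtPrime_iff_hasGoodReductionAt_ringOfIntegers v₀ W).mpr hgood₀
    have h2 := @not_dvd_minimalDiscriminantInt_of_hasGoodReductionAtPrime' W _
      (Rat.HeightOneSpectrum.primesEquiv v₀ : ℕ) (Fact.mk (Rat.HeightOneSpectrum.primesEquiv v₀).2) h1
    rwa [hv₀] at h2
  -- `p ∣ ℓ + 1`, `p ∣ a_ℓ`; `p^M ∣ ℓ + 1`
  obtain ⟨hpl, hpa⟩ := hℓ.dvd
  obtain ⟨hplM, -⟩ := Zhang2014.le_kolyvaginIndex_iff.mp hℓM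
  -- the Frobenius of `𝔽̄_ℓ`
  obtain ⟨φ₀, hφ₀'⟩ := exists_frobenius_absoluteGaloisGroup (ZMod ℓ)
  have hφ₀ : ∀ x : AlgebraicClosure (ZMod ℓ), φ₀ • x = x ^ ℓ := fun x ↦ by
    rw [hφ₀' x, Nat.card_zmod]
  -- ### the local prime, a Frobenius `F₀` at it fixing `E[p^M]`; inertia fixes `E[p^M]`
  obtain ⟨𝔐, h𝔐⟩ := v.localPrimesAbove_nonempty
  set 𝔓 := v.primeBelow (closureEmb (K := K) (v.adicCompletion K)) 𝔐 with h𝔓def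
  have h𝔓 : 𝔓 ∈ v.primesAbove := HeightOneSpectrum.primeBelow_mem_primesAbove h𝔐
  obtain ⟨F₀, hF₀, hF₀fix⟩ :=
    exists_isArithFrobAt_mem_torsionFixing_of_le_kolyvaginIndex W hK hℓ hℓM hℓv hgoodQ hv h𝔓
  obtain ⟨-, red₀, -, -, -, hredI₀, -, hred₀, -, -, -, -⟩ :=
    exists_reductionDatum_of_not_dvd_conductorNorm hΔ hp2 hpℓ hℓ.2.1 hpl hpa hφ₀ hv huniq hres h𝔓
      hℓpM hq0 hF₀ hF₀fix
  have hIfix : ∀ τ ∈ 𝔓.inertia (absoluteGaloisGroup K), τ ∈ torsionFixing (W.baseChange K) nn := by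
    intro τ hτ
    rw [mem_torsionFixing_iff]
    intro T
    apply Subtype.ext
    have hT : nn • (T : geomPoints (W.baseChange K)) = 0 := by
      have h := T.2
      rwa [mem_geomTorsion_iff] at h
    have h1 : nn • (τ • (T : geomPoints (W.baseChange K)) - T) = 0 := by
      rw [smul_sub, smul_comm, hT, smul_zero, sub_self]
    have h2 : red₀ (τ • (T : geomPoints (W.baseChange K)) - T) = 0 := by
      rw [map_sub, hredI₀ τ hτ, sub_self]
    exact sub_eq_zero.mp (hred₀ _ h1 h2)
  -- ### `F₀` restricts into `G_ℓ = ⟨σ_ℓ⟩`: it fixes `K[n/ℓ]`, in which `λ` splits completely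
  have hle : ringClassField K ι (n / ℓ) ≤ ringClassField K ι n :=
    ringClassField_mono hK ι (Nat.div_dvd_of_dvd hℓn) hn0
  haveI := (finiteDimensional_and_isGalois_ringClassField hK ι hm0).1
  haveI := (finiteDimensional_and_isGalois_ringClassField hK ι hm0).2
  haveI : NumberField (ringClassField K ι (n / ℓ)) := NumberField.of_module_finite K _
  have hvs : v ∈ splitPrimes K (ringClassField K ι (n / ℓ)) :=
    mem_splitPrimes_ringClassField_of_span_natCast hK ι hm0
      (asIdeal_eq_span_of_natCast_mem hℓp hℓ.2.2.2.2.1 hv) ((Nat.Prime.coprime_iff_not_dvd hℓp).mpr hℓn')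
  set e' : ringClassField K ι (n / ℓ) →ₐ[K] AlgebraicClosure K := e.comp (RingClassField.inclusion ι hle)
    with he'
  have hF₀G : ρ (π F₀) ∈ ringClassGalOver ι n (n / ℓ) := by
    rw [ringClassGalOver, mem_fixingSubgroup_iff]
    intro x hx
    rw [AlgEquiv.smul_def]
    set x' : ringClassField K ι (n / ℓ) := ⟨(x : ℂ), hx⟩ with hx'
    have hxx' : RingClassField.inclusion ι hle x' = x :=
      Subtype.ext (RingClassField.coe_inclusion ι hle x')
    have h := smul_algHom_eq_self_of_mem_splitPrimes e' hvs h𝔓 hF₀ x'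
    rw [he', AlgHom.comp_apply, hxx', hπρ] at h
    exact e.injective h
  rw [← hσρ, Subgroup.mem_map] at hF₀G
  obtain ⟨g, hg, hgeq⟩ := hF₀G
  have hπF₀ : π F₀ ∈ Subgroup.zpowers (σ ℓ) := by rwa [← hρ hgeq]
  have hfin : IsOfFinOrder (σ ℓ) := isOfFinOrder_iff_pow_eq_one.mpr ⟨ℓ + 1, Nat.succ_pos ℓ, hord⟩
  obtain ⟨i₀, hi₀⟩ := (hfin.mem_powers_iff_mem_zpowers).mpr hπF₀
  have hi₀' : σ ℓ ^ i₀ = π F₀ := hi₀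
  -- ### `τ₀ ∈ I_𝔓` over `σ_ℓ` (total ramification), and the Frobenius `F = τ₀^j F₀` with `π F = 1`
  have hσmem : ρ (σ ℓ) ∈ ringClassGalOver ι n (n / ℓ) := by
    rw [← hσρ]; exact Subgroup.mem_map_of_mem _ (Subgroup.mem_zpowers _)
  obtain ⟨τ₀, hτ₀I, hτ₀⟩ := RingClassTower.exists_mem_inertia_smul_eq_of_mem_ringClassGalOver hK ι hn0 hℓp hℓn
    hℓn' (fun w ↦ ⟨fun hw ↦ huniq w hw, fun h ↦ h ▸ hv⟩) h𝔓 e hσmem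
  have hπτ₀ : π τ₀ = σ ℓ := by
    refine hρ (AlgEquiv.ext fun x ↦ ?_)
    have h := hτ₀ x
    rw [hπρ] at h
    exact e.injective h
  set jj : ℕ := (ℓ + 1) - i₀ % (ℓ + 1) with hjj
  set F : absoluteGaloisGroup K := τ₀ ^ jj * F₀ with hFdef
  have hπF : π F = 1 := by
    have hr : i₀ % (ℓ + 1) < ℓ + 1 := Nat.mod_lt _ (Nat.succ_pos ℓ)
    have hσi₀ : σ ℓ ^ i₀ = σ ℓ ^ (i₀ % (ℓ + 1)) := by
      conv_lhs => rw [← Nat.div_add_mod i₀ (ℓ + 1), pow_add, pow_mul, hord, one_pow, one_mul]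
    rw [hFdef, map_mul, map_pow, hπτ₀, ← hi₀', hσi₀, ← pow_add, hjj, Nat.sub_add_cancel hr.le, hord]
  have hF : IsArithFrobAt (𝓞 K) F 𝔓 := isArithFrobAt_mul_of_mem_inertia hF₀ (pow_mem hτ₀I jj)
  have hFfix : F ∈ torsionFixing (W.baseChange K) nn :=
    (torsionFixing (W.baseChange K) nn).mul_mem (hIfix _ (pow_mem hτ₀I jj)) hF₀fix
  -- `F` fixes `j(A₀)` pointwise
  have hFj : ∀ z : A₀, F • j z = j z := fun z ↦ by rw [← hj, hπF, one_smul]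
  -- ### the reduction datum for `F`
  obtain ⟨-, red, φ, -, -, hredI, hredF, hred, hBn, -, -, -⟩ :=
    exists_reductionDatum_of_not_dvd_conductorNorm hΔ hp2 hpℓ hℓ.2.1 hpl hpa hφ₀ hv huniq hres h𝔓
      hℓpM hq0 hF hFfix
  -- ### `k c(P) = c(kP)`, Selmer at `λ`
  obtain ⟨Q, hQ⟩ := hdiv P
  have hkP : k • P ∈ invPoints (absoluteGaloisGroup K) j.range nn := AddSubgroup.zsmul_mem _ hPt k
  have hkQ : nn • (k • Q) = k • P := by rw [smul_comm, hQ]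
  have hcls : k • kolyvaginClass (W.baseChange K) nn hdiv hA P hPt =
      kolyvaginClass (W.baseChange K) nn hdiv hA (k • P) hkP := by
    rw [kolyvaginClass_eq_cls hA hPt hQ, ← cls_zsmul hA _ hPt hQ k hkP hkQ, ← kolyvaginClass_eq_cls hA hkP hkQ]
  rw [hcls] at hsel ⊢
  have hFP : F • (k • P) = k • P := by rw [hPdef, ← map_zsmul, hFj]
  -- ### the criterion for an unramified class at a good place (Gross Prop. 9.6)
  have hcrit := zsmul_kolyvaginClass_mem_torsionLocalKer_iff_of_red (W.baseChange K) hA hkP hgood hnv hn0Z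
    h𝔐 hF hFfix (torsionPointsMap_bijective (W.baseChange K) (v.adicCompletion K) hq0).2 hsel hFP red
    (φ.comp φ) (fun x ↦ hredF x) hred (fun b hb ↦ hBn b hb) 1
  rw [one_zsmul, one_zsmul] at hcrit
  rw [hcrit]
  -- ### `red(k P) = k · ℓ(ℓ+1)/2 · red(P') ∈ p^M · Ẽ(F_λ)`
  set P' : A₀ := kolyvaginPoint σ (L.erase ℓ) f y with hP'
  have hredpow : ∀ (i : ℕ) (z : A₀), red (j (σ ℓ ^ i • z)) = red (j z) := fun i z ↦ by
    rw [← hπτ₀, ← map_pow, hj, hredI _ (pow_mem hτ₀I i)]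
  have hredP : red P = (∑ i ∈ Finset.range (ℓ + 1), i) • red (j P') := by
    rw [hPdef, kolyvaginPoint_eq_grAct_derivElt_erase σ hℓL f y, grAct_derivElt, map_sum, map_sum,
      Finset.sum_smul]
    refine Finset.sum_congr rfl fun i _ ↦ ?_
    rw [map_nsmul, map_nsmul, hredpow]
  -- `p^M ∣ Σ_{i ≤ ℓ} i = ℓ(ℓ+1)/2` (`p` odd, `p^M ∣ ℓ + 1`)
  obtain ⟨c, hc⟩ : p ^ M ∣ ∑ i ∈ Finset.range (ℓ + 1), i := by
    have h2 : Nat.Coprime (p ^ M) 2 :=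
      Nat.Coprime.pow_left M ((Nat.coprime_primes hp Nat.prime_two).mpr hp2)
    refine h2.dvd_of_dvd_mul_right ?_
    rw [Finset.sum_range_id_mul_two, Nat.add_sub_cancel]
    exact Dvd.dvd.mul_right hplM ℓ
  refine ⟨(k * c) • red (j P'), ?_, ?_⟩
  · -- fixed by `φ²`: `F` fixes `j P'`
    rw [map_zsmul, AddMonoidHom.comp_apply, ← hredF, hFj]
  · rw [map_zsmul, hredP, hc, ← natCast_zsmul, smul_smul, hnn, smul_smul]
    congr 1
    push_cast
    ring

/-! ## §3 The same for the concrete class of a Kolyvagin–Heegner datum -/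

/-- **`ord d_M(n)_λ = ord c_M(n)_λ` for the CONCRETE class of a Kolyvagin–Heegner datum** at a Zhang–Kolyvagin level:
for `d : KolyvaginHeegnerData Dt β ι n` (`n` square-free, all prime factors Zhang–Kolyvagin of index `≥ M`), a prime
factor `ℓ` of `n`, the place `λ ∋ ℓ`, and McCallum's standing inputs at level `n` (`hA`: `E(K[n]) ⊆ E(K̄)` admissible
for `p^M`; `hPt`: `[P(n)]` invariant mod `p^M`), for every `k`:
`k · c_M(n) ∈ Sel_λ ↔ k · c_M(n)_λ = 0` (McCallum Prop. 4.4 (3) in order form; the level data and the Galois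
dictionary are supplied from the datum as in x11b3's `exists_levelData`). [cite: McCallumLMS1991, Prop. 4.4 (3)
(p. 301)] [cite: GrossLMS1991, Prop. 9.6, §4 (4.1)] [cite: WZhang2014, Notations (xii)] -/
theorem zsmul_kolyvaginClass_mem_selmerLocalKer_iff_mem_torsionLocalKer_of_datum
    {N : ℕ} [NeZero N] {Dt : ModularParametrizationData W N} {β : ℤ}
    (hK : IsImaginaryQuadratic K) (ι : K →+* ℂ) {p M : ℕ} (hp : p.Prime) (hp2 : p ≠ 2)
    {n : ℕ} (hn : Squarefree n)
    (hkol : ∀ q ∈ n.primeFactors, Zhang2014.IsKolyvaginPrime (W.conductorNorm ℤ) W K p q ∧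
      M ≤ Zhang2014.kolyvaginIndex W p q)
    {ℓ : ℕ} (hℓ : ℓ ∈ n.primeFactors) (d : KolyvaginHeegnerData Dt β ι n)
    (hA : IsAdmissible (absoluteGaloisGroup K) d.pointsSubgroup ((p ^ M : ℕ) : ℤ))
    (hPt : d.toGeomPoints d.derivedPoint ∈
      invPoints (absoluteGaloisGroup K) d.pointsSubgroup ((p ^ M : ℕ) : ℤ))
    (v : HeightOneSpectrum (𝓞 K)) (hv : (ℓ : 𝓞 K) ∈ v.asIdeal) (k : ℤ) :
    k • d.kolyvaginClass hp M ∈ selmerLocalKer (W.baseChange K) (v.adicCompletion K) ((p ^ M : ℕ) : ℤ) ↔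
      k • d.kolyvaginClass hp M ∈ (W.baseChange K).torsionLocalKer (v.adicCompletion K) ((p ^ M : ℕ) : ℤ) := by
  refine ⟨fun hsel ↦ ?_,
    fun h ↦ (W.baseChange K).torsionLocalKer_le_selmerLocalKer (v.adicCompletion K) _ h⟩
  letI : Algebra K ℂ := ι.toAlgebra
  have hn0 : n ≠ 0 := Squarefree.ne_zero hn
  obtain ⟨hℓp, hℓn, -⟩ := Nat.mem_primeFactors.mp hℓ
  have hℓn' : ¬ ℓ ∣ n / ℓ := not_dvd_div_of_squarefree_of_prime hn hℓp hℓn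
  have hinert : ∀ q ∈ n.primeFactors, (Ideal.span {(q : 𝓞 K)}).IsPrime :=
    fun q hq ↦ (hkol q hq).1.2.2.2.2.1
  have hdiv : ∀ Q : geomPoints (W.baseChange K), ∃ R, ((p ^ M : ℕ) : ℤ) • R = Q :=
    (W.baseChange K).zsmul_geomPoints_surjective_of_charZero
      (by exact_mod_cast pow_ne_zero M hp.ne_zero)
  -- the level data of `d`
  obtain ⟨σ, H, f, y, π, j, e, hord, hj, hπρ, hfsec, hHρ, hdict, -⟩ :=
    exists_levelData_of (W := W) (Dt := Dt) (β := β) hK ι (fun k ↦ k = n) (fun k (hk : k = n) ↦ hk ▸ hn)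
      (fun k (hk : k = n) ↦ hk ▸ hinert) (fun k (hk : k = n) ↦ hk ▸ d) n
  obtain ⟨hjd, hyd, hσd, hfS⟩ := hdict rfl
  letI hcg : CommGroup (ringClassGal ι n) :=
    { (inferInstance : Group (ringClassGal ι n)) with
      mul_comm := fun a b ↦ (isMulCommutative_ringClassGal' hK ι n).is_comm.comm a b }
  haveI hfin : Finite (ringClassGal ι n) := finite_ringClassGal hK ι n
  letI act : DistribMulAction (ringClassGal ι n) ((W.baseChange (ringClassField K ι n)).toAffine.Point) :=
    DistribMulAction.compHom _ ((pointGalHom W (ringClassField K ι n)).comp (ringClassGal ι n).subtype)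
  letI hft : Fintype (ringClassGal ι n ⧸ H) := Fintype.ofFinite _
  set ρ : ringClassGal ι n →* (ringClassField K ι n ≃ₐ[ℚ] ringClassField K ι n) :=
    (ringClassGal ι n).subtype with hρdef
  have hρ : Function.Injective ρ := (ringClassGal ι n).subtype_injective
  have hsmul : ∀ (g : ringClassGal ι n) (Q : (W.baseChange (ringClassField K ι n)).toAffine.Point),
      g • Q = pointGalHom W (ringClassField K ι n) (ρ g) Q := fun _ _ ↦ rfl
  have hj' : ∀ (g : absoluteGaloisGroup K) (a : (W.baseChange (ringClassField K ι n)).toAffine.Point),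
      j (π g • a) = g • j a := fun g a ↦ by rw [hsmul]; exact hj g a
  -- the abstract Kolyvagin point is `P(n)` (x11b3-p8's G1)
  have hbij : Set.BijOn (fun c : ringClassGal ι n ⧸ H ↦ ρ (f c)) Set.univ (d.S : Set _) :=
    KolyvaginH37Bridge.bijOn_of_section_of_transversal ρ hρ (H := H) (Γ := ringClassGal ι n)
      (G₁ := ringClassGalOver ι n 1) hHρ (S := (d.S : Set _)) (fun s hs ↦ d.S_subset s hs)
      (fun s hs ↦ ⟨⟨s, d.S_subset s hs⟩, rfl⟩) d.S_transversal f hfsec hfS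
  have hP : j (kolyvaginPoint σ n.primeFactors f y) = d.toGeomPoints d.derivedPoint := by
    rw [hjd, hyd]
    congr 1
    exact KolyvaginH37Bridge.map_kolyvaginPoint_eq_derivedPoint (pointGalHom W (ringClassField K ι n)) ρ
      (AddMonoidHom.id _) (fun g a ↦ hsmul g a) hn hσd f hbij d.y
  have hA' : IsAdmissible (absoluteGaloisGroup K) j.range ((p ^ M : ℕ) : ℤ) := by rw [hjd]; exact hA
  have hPt' : j (kolyvaginPoint σ n.primeFactors f y) ∈
      invPoints (absoluteGaloisGroup K) j.range ((p ^ M : ℕ) : ℤ) := by rw [hP, hjd]; exact hPt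
  have hc : d.kolyvaginClass hp M =
      kolyvaginClass (W.baseChange K) ((p ^ M : ℕ) : ℤ) hdiv hA'
        (j (kolyvaginPoint σ n.primeFactors f y)) hPt' := by
    rw [KolyvaginHeegnerData.kolyvaginClass_of_admissible _ hp M hA hPt]
    exact kolyvaginClass_congr (by rw [hjd]; rfl) hP.symm
  have hσℓ : ρ (σ ℓ) = d.σ ℓ := hσd ℓ hℓ
  have hσρ : (Subgroup.zpowers (σ ℓ)).map ρ = ringClassGalOver ι n (n / ℓ) := by
    rw [MonoidHom.map_zpowers, hσℓ, d.zpowers_σ ℓ hℓ]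
  rw [hc] at hsel ⊢
  exact zsmul_kolyvaginClass_mem_torsionLocalKer_of_mem_selmerLocalKer hK ι hp hp2 hdiv σ n.primeFactors f y π j
    hj' hA' hPt' hn0 e ρ hρ hπρ hℓ hℓn hℓn' (hkol ℓ hℓ).1 (hkol ℓ hℓ).2 (hord ℓ hℓ) hσρ v hv k hsel

end Ramified

end Summit.BirchSwinnertonDyer.BirchSwinnertonDyer.Theorems.Prop44

end
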